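import Summits.NavierStokesRegularity.NavierStokesRegularity.Theses.CoreLogGas
import HarnessLib.Audit

/-!
# Evidence C3 — crux `CoreLogGas.LocallyDrivenIsTypeI` (stmt-NavierStokesRegularity-11290), line `registered`

Lead c3 (prover-line-stmt-NavierStokesRegularity-11290-c3-0), 2026-08-17. Kernel-checked bookkeeping for the third
`line-dead` verdict on the birth skeleton (Lines/birth.lean, sha cfe55300…). Nothing here proves or refutes the crux.

1. `vorticityTypeI_of_core_and_flux` — the registered stubs `stub_parabolicCore` and `stub_fluxBudget` JOINTLY assert the
   vorticity Type-I rate `Ω(t)·(T − t) ≤ Γ₀/c` for H-solutions (the skeleton's design note "no stub is itself a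
   blow-up-rate statement" holds stub-by-stub only; the pair is the rate, and `stub_parabolicCore` alone is the in-radius
   form of it). So the line asks its workers for an a-priori UPPER bound of Type-I strength on a hypothetical blow-up.
2. `upper_rate_of_lower_growth` / `lower_rate_of_upper_growth` — the direction bookkeeping of the max-point ODE, as pure
   real analysis: a LOWER bound `f' ≥ k f²` on the growth of a positive quantity caps it by the Type-I envelope
   `f(t) ≤ 1/(k (T − t))`, whereas an UPPER bound `f' ≤ K f²` on a quantity unbounded at `T` only FLOORS it,
   `f(t) ≥ 1/(K (T − t))` (the Beale–Kato–Majda / Leray direction). The locality hypothesis H of the crux is an upper bound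
   (on the exterior symmetric strain at deep points); fed into `D⁺Ω ≤ (α_ext + α_loc) Ω` it can only produce floors, never
   the Type-I cap — which would need `α(x*, t) ≥ k Ω(t)` at the vorticity maximum, a LOWER bound on total stretching that
   no hypothesis of H's kind supplies (and that is false for the lone straight tube, α_loc = 0 on the axis).
-/

noncomputable section

open Set Filter Topology

namespace Summit.NavierStokesRegularity.NavierStokesRegularity.Cruxes.LocallyDrivenIsTypeI.EvidenceC3

set_option linter.dupNamespace false

/-- The crux's hypothesis block on `(ν, T, u, p)`: maximal smooth solution, Leray–Hopf, decaying datum, and the locality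
hypothesis `H(M, t₀, g)` — verbatim the binder text of `CoreLogGas.LocallyDrivenIsTypeI`. -/
def CruxHyp (ν T : ℝ) (u : ℝ → EuclideanSpace ℝ (Fin 3) → EuclideanSpace ℝ (Fin 3))
    (p : ℝ → EuclideanSpace ℝ (Fin 3) → ℝ) : Prop :=
  Literature.Analysis.FluidPDE.IsMaximalSmoothSolution ν 0 u p T ∧
    Literature.Analysis.FluidPDE.IsLerayHopfOn T ν 0 (u 0) u ∧
    Literature.Analysis.FluidPDE.HasRapidSpatialDecay (u 0) ∧
    (∃ (M t₀ : ℝ) (g : ℝ → ℝ), 1 ≤ M ∧ 0 ≤ t₀ ∧ t₀ < T ∧ MeasureTheory.IntegrableOn g (Set.Ico t₀ T) ∧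
      ∀ t ∈ Set.Ico t₀ T, ∀ (x : EuclideanSpace ℝ (Fin 3)) (ρ : ℝ), 0 < ρ →
        (⨆ z, ‖Literature.Analysis.FluidPDE.curl (u t) z‖) ≤ 2 * ‖Literature.Analysis.FluidPDE.curl (u t) x‖ →
        Metric.ball x ρ ⊆ {y | (⨆ z, ‖Literature.Analysis.FluidPDE.curl (u t) z‖) ≤
          4 * ‖Literature.Analysis.FluidPDE.curl (u t) y‖} →
        (∀ (x' : EuclideanSpace ℝ (Fin 3)) (ρ' : ℝ),
          (⨆ z, ‖Literature.Analysis.FluidPDE.curl (u t) z‖) ≤ 2 * ‖Literature.Analysis.FluidPDE.curl (u t) x'‖ →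
          Metric.ball x' ρ' ⊆ {y | (⨆ z, ‖Literature.Analysis.FluidPDE.curl (u t) z‖) ≤
            4 * ‖Literature.Analysis.FluidPDE.curl (u t) y‖} →
          ρ' ≤ 2 * ρ) →
        ∀ e : EuclideanSpace ℝ (Fin 3), ‖e‖ = 1 →
          |inner ℝ ((fderiv ℝ (u t) x - fderiv ℝ (fun z : EuclideanSpace ℝ (Fin 3) =>
            ∫ y, (4 * Real.pi * ‖z - y‖ ^ 3)⁻¹ • Literature.Analysis.FluidPDE.cross
              ((Metric.ball x (M * ρ)).indicator (Literature.Analysis.FluidPDE.curl (u t)) y) (z - y)) x) e) e| ≤ g t)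

/-- Conclusion of the registered stub `stub_fluxBudget` (core flux budget `Ω(t)·ρ² ≤ Γ₀` at deep inscribed balls). -/
def FluxBudgetConcl (T : ℝ) (u : ℝ → EuclideanSpace ℝ (Fin 3) → EuclideanSpace ℝ (Fin 3)) : Prop :=
  ∃ (Γ₀ t₁ : ℝ), 0 < Γ₀ ∧ t₁ < T ∧ ∀ t ∈ Set.Ico t₁ T, ∀ (x : EuclideanSpace ℝ (Fin 3)) (ρ : ℝ), 0 < ρ →
    (⨆ z, ‖Literature.Analysis.FluidPDE.curl (u t) z‖) ≤ 2 * ‖Literature.Analysis.FluidPDE.curl (u t) x‖ →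
    Metric.ball x ρ ⊆ {y | (⨆ z, ‖Literature.Analysis.FluidPDE.curl (u t) z‖) ≤
      4 * ‖Literature.Analysis.FluidPDE.curl (u t) y‖} →
    (⨆ z, ‖Literature.Analysis.FluidPDE.curl (u t) z‖) * ρ ^ 2 ≤ Γ₀

/-- Conclusion of the registered stub `stub_parabolicCore` (a deep inscribed ball of radius `ρ² ≥ c (T − t)`). -/
def ParabolicCoreConcl (T : ℝ) (u : ℝ → EuclideanSpace ℝ (Fin 3) → EuclideanSpace ℝ (Fin 3)) : Prop :=
  ∃ (c t₁ : ℝ), 0 < c ∧ t₁ < T ∧ ∀ t ∈ Set.Ico t₁ T, ∃ (x : EuclideanSpace ℝ (Fin 3)) (ρ : ℝ), 0 < ρ ∧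
    (⨆ z, ‖Literature.Analysis.FluidPDE.curl (u t) z‖) ≤ 2 * ‖Literature.Analysis.FluidPDE.curl (u t) x‖ ∧
    Metric.ball x ρ ⊆ {y | (⨆ z, ‖Literature.Analysis.FluidPDE.curl (u t) z‖) ≤
      4 * ‖Literature.Analysis.FluidPDE.curl (u t) y‖} ∧
    c * (T - t) ≤ ρ ^ 2

/-- The vorticity Type-I rate near `T`: `Ω(t) · (T − t) ≤ C₁` on a left neighbourhood of `T`. -/
def VorticityTypeIRate (T : ℝ) (u : ℝ → EuclideanSpace ℝ (Fin 3) → EuclideanSpace ℝ (Fin 3)) : Prop :=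
  ∃ (C₁ t₁ : ℝ), t₁ < T ∧ ∀ t ∈ Set.Ico t₁ T,
    (⨆ z, ‖Literature.Analysis.FluidPDE.curl (u t) z‖) * (T - t) ≤ C₁

/-- **(1) The registered stubs jointly contain the vorticity Type-I rate.** For any field `u` and time `T`, the
conclusions of `stub_fluxBudget` and `stub_parabolicCore` together give `Ω(t)·(T − t) ≤ Γ₀ / c` on `[max t₁ t₂, T)`:
flux budget at the parabolic core, `Ω ≤ Γ₀/ρ² ≤ Γ₀/(c (T − t))`. Pure arithmetic (the first half of the skeleton's
composition `Birth.LocallyDrivenIsTypeI_of`); no NS input. -/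
theorem vorticityTypeI_of_core_and_flux (T : ℝ) (u : ℝ → EuclideanSpace ℝ (Fin 3) → EuclideanSpace ℝ (Fin 3))
    (hflux : FluxBudgetConcl T u) (hcore : ParabolicCoreConcl T u) : VorticityTypeIRate T u := by
  obtain ⟨Γ₀, t₁, hΓ₀, ht₁, hflux⟩ := hflux
  obtain ⟨c, t₂, hc, ht₂, hcore⟩ := hcore
  refine ⟨Γ₀ / c, max t₁ t₂, max_lt ht₁ ht₂, ?_⟩
  intro t ht
  have h₁ : t₁ ≤ t := le_trans (le_max_left t₁ t₂) ht.1
  have h₂ : t₂ ≤ t := le_trans (le_max_right t₁ t₂) ht.1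
  have hTt : 0 < T - t := sub_pos.mpr ht.2
  obtain ⟨x₀, ρ, hρ, hdeep, hins, hρT⟩ := hcore t ⟨h₂, ht.2⟩
  have hΩρ := hflux t ⟨h₁, ht.2⟩ x₀ ρ hρ hdeep hins
  have hρ2 : 0 < ρ ^ 2 := by positivity
  have hcT : 0 < c * (T - t) := mul_pos hc hTt
  have hΩle : (⨆ z, ‖Literature.Analysis.FluidPDE.curl (u t) z‖) ≤ Γ₀ / (c * (T - t)) := by
    have h1 : (⨆ z, ‖Literature.Analysis.FluidPDE.curl (u t) z‖) ≤ Γ₀ / ρ ^ 2 := by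
      rw [le_div_iff₀ hρ2]; exact hΩρ
    exact h1.trans (div_le_div_of_nonneg_left hΓ₀.le hcT hρT)
  calc (⨆ z, ‖Literature.Analysis.FluidPDE.curl (u t) z‖) * (T - t)
      ≤ Γ₀ / (c * (T - t)) * (T - t) := mul_le_mul_of_nonneg_right hΩle hTt.le
    _ = Γ₀ / c := by field_simp

/-- The crux-level form of (1): IF the two registered stubs hold as filed (their full signatures, crux hypotheses
included), then every H-solution blows up at most at the vorticity Type-I rate — i.e. the pair of stubs is an a-priori
Type-I bound for the class of hypothetical blow-ups the crux is about. -/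
theorem stubs_give_vorticityTypeI
    (hFlux : ∀ (ν T : ℝ), 0 < ν → 0 < T → ∀ u p, CruxHyp ν T u p → FluxBudgetConcl T u)
    (hCore : ∀ (ν T : ℝ), 0 < ν → 0 < T → ∀ u p, CruxHyp ν T u p → ParabolicCoreConcl T u) :
    ∀ (ν T : ℝ), 0 < ν → 0 < T → ∀ u p, CruxHyp ν T u p → VorticityTypeIRate T u :=
  fun ν T hν hT u p h =>
    vorticityTypeI_of_core_and_flux T u (hFlux ν T hν hT u p h) (hCore ν T hν hT u p h)

/-! ### (2) Direction bookkeeping for max-point differential inequalities -/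

/-- Derivative of `s ↦ (f s)⁻¹ + k s` at a point where `f` is differentiable and nonzero. -/
theorem hasDerivAt_inv_add_linear {f : ℝ → ℝ} {s k : ℝ} (hds : DifferentiableAt ℝ f s) (hfs : f s ≠ 0) :
    HasDerivAt (fun y => (f y)⁻¹ + k * y) (-(f s ^ 2)⁻¹ * deriv f s + k) s := by
  have h1 : HasDerivAt (fun y => (f y)⁻¹) (-(f s ^ 2)⁻¹ * deriv f s) s :=
    (hasDerivAt_inv hfs).comp s hds.hasDerivAt
  have h2 : HasDerivAt (fun y => k * y) k s := by
    simpa using (hasDerivAt_id s).const_mul k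
  exact h1.add h2

/-- **Type I needs a LOWER bound on growth.** If `f > 0` on `[a, T)` is continuous there, differentiable on `(a, T)`,
and grows at least quadratically, `k · f(s)² ≤ f'(s)` with `k > 0`, then `f` sits under the Type-I envelope:
`f(t) · (T − t) ≤ 1/k` for every `t ∈ [a, T)`. (Proof: `1/f + k·s` is non-increasing; `1/f > 0` at any later `s`.)
This is the only way a max-point ODE yields an upper rate: it needs a floor on the stretching at the maximum. -/
theorem upper_rate_of_lower_growth {f : ℝ → ℝ} {a T k : ℝ} (hk : 0 < k)
    (hcont : ContinuousOn f (Ico a T)) (hdiff : DifferentiableOn ℝ f (Ioo a T))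
    (hpos : ∀ s ∈ Ico a T, 0 < f s) (hgrowth : ∀ s ∈ Ioo a T, k * f s ^ 2 ≤ deriv f s) :
    ∀ t ∈ Ico a T, f t * (T - t) ≤ 1 / k := by
  -- φ(s) := 1/f(s) + k s is antitone on [a, T)
  set φ : ℝ → ℝ := fun s => (f s)⁻¹ + k * s with hφ
  have hφcont : ContinuousOn φ (Ico a T) :=
    (hcont.inv₀ fun s hs => (hpos s hs).ne').add (continuousOn_const.mul continuousOn_id)
  have hint : interior (Ico a T) = Ioo a T := interior_Ico
  have hφdiff : DifferentiableOn ℝ φ (interior (Ico a T)) := by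
    rw [hint]
    intro s hs
    have hds : DifferentiableAt ℝ f s := hdiff.differentiableAt (Ioo_mem_nhds hs.1 hs.2)
    exact (hasDerivAt_inv_add_linear hds (hpos s (Ioo_subset_Ico_self hs)).ne').differentiableAt
      |>.differentiableWithinAt
  have hφderiv : ∀ s ∈ interior (Ico a T), deriv φ s ≤ 0 := by
    rw [hint]
    intro s hs
    have hfs : 0 < f s := hpos s (Ioo_subset_Ico_self hs)
    have hds : DifferentiableAt ℝ f s := hdiff.differentiableAt (Ioo_mem_nhds hs.1 hs.2)
    rw [(hasDerivAt_inv_add_linear (k := k) hds hfs.ne').deriv]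
    have hf2 : 0 < f s ^ 2 := by positivity
    have hq : k ≤ (f s ^ 2)⁻¹ * deriv f s := by
      rw [← div_eq_inv_mul, le_div_iff₀ hf2]
      exact hgrowth s hs
    linarith
  have hanti : AntitoneOn φ (Ico a T) :=
    antitoneOn_of_deriv_nonpos (convex_Ico a T) hφcont hφdiff hφderiv
  intro t ht
  have hft : 0 < f t := hpos t ht
  -- for every s ∈ (t, T): k (s - t) ≤ 1 / f t
  have key : ∀ s ∈ Ioo t T, k * (s - t) ≤ (f t)⁻¹ := by
    intro s hs
    have hsI : s ∈ Ico a T := ⟨ht.1.trans hs.1.le, hs.2⟩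
    have hmono := hanti ht hsI hs.1.le
    have hfs : 0 < (f s)⁻¹ := inv_pos.mpr (hpos s hsI)
    have h1 : (f s)⁻¹ + k * s ≤ (f t)⁻¹ + k * t := hmono
    have h2 : k * (s - t) = k * s - k * t := by ring
    linarith
  -- pass to the limit s → T
  have hlim : k * (T - t) ≤ (f t)⁻¹ := by
    apply le_of_forall_pos_lt_add
    intro ε hε
    set δ : ℝ := min ((T - t) / 2) (ε / (2 * k)) with hδ
    have hδ1 : δ ≤ (T - t) / 2 := min_le_left _ _
    have hδ2 : δ ≤ ε / (2 * k) := min_le_right _ _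
    have hδpos : 0 < δ := lt_min (by linarith [ht.2]) (by positivity)
    have hs : T - δ ∈ Ioo t T := ⟨by linarith [ht.2], by linarith⟩
    have h := key (T - δ) hs
    have hkδ : k * δ ≤ ε / 2 := by
      calc k * δ ≤ k * (ε / (2 * k)) := mul_le_mul_of_nonneg_left hδ2 hk.le
        _ = ε / 2 := by field_simp
    have h3 : k * (T - t) = k * (T - δ - t) + k * δ := by ring
    linarith
  have h1 : f t * (k * (T - t)) ≤ f t * (f t)⁻¹ := mul_le_mul_of_nonneg_left hlim hft.le
  rw [mul_inv_cancel₀ hft.ne'] at h1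
  rw [le_div_iff₀ hk]
  have h2 : f t * (T - t) * k = f t * (k * (T - t)) := by ring
  linarith

/-- **An UPPER bound on growth only floors the rate (Beale–Kato–Majda / Leray direction).** If `f > 0` on `[a, T)` is
continuous there, differentiable on `(a, T)`, grows at most quadratically, `f'(s) ≤ K · f(s)²`, and is unbounded near
`T` (for every `N` and every `t' < T` some `s ∈ (t', T)` has `N ≤ f(s)`), then `1 ≤ K · f(t) · (T − t)` on `[a, T)` —
a LOWER bound on the blow-up rate, never an upper one. With `f = Ω` and `K = sup (α_ext + α_loc)/Ω` this is all the
max-point inequality can extract from an upper bound on the stretching such as the crux's H. -/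
theorem lower_rate_of_upper_growth {f : ℝ → ℝ} {a T K : ℝ} (hK : 0 ≤ K)
    (hcont : ContinuousOn f (Ico a T)) (hdiff : DifferentiableOn ℝ f (Ioo a T))
    (hpos : ∀ s ∈ Ico a T, 0 < f s) (hgrowth : ∀ s ∈ Ioo a T, deriv f s ≤ K * f s ^ 2)
    (hub : ∀ (N t' : ℝ), t' < T → ∃ s ∈ Ioo t' T, N ≤ f s) :
    ∀ t ∈ Ico a T, 1 ≤ K * f t * (T - t) := by
  -- ψ(s) := 1/f(s) + K s is monotone on [a, T)
  set ψ : ℝ → ℝ := fun s => (f s)⁻¹ + K * s with hψ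
  have hψcont : ContinuousOn ψ (Ico a T) :=
    (hcont.inv₀ fun s hs => (hpos s hs).ne').add (continuousOn_const.mul continuousOn_id)
  have hint : interior (Ico a T) = Ioo a T := interior_Ico
  have hψdiff : DifferentiableOn ℝ ψ (interior (Ico a T)) := by
    rw [hint]
    intro s hs
    have hds : DifferentiableAt ℝ f s := hdiff.differentiableAt (Ioo_mem_nhds hs.1 hs.2)
    exact (hasDerivAt_inv_add_linear hds (hpos s (Ioo_subset_Ico_self hs)).ne').differentiableAt
      |>.differentiableWithinAt
  have hψderiv : ∀ s ∈ interior (Ico a T), 0 ≤ deriv ψ s := by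
    rw [hint]
    intro s hs
    have hfs : 0 < f s := hpos s (Ioo_subset_Ico_self hs)
    have hds : DifferentiableAt ℝ f s := hdiff.differentiableAt (Ioo_mem_nhds hs.1 hs.2)
    rw [(hasDerivAt_inv_add_linear (k := K) hds hfs.ne').deriv]
    have hf2 : 0 < f s ^ 2 := by positivity
    have hq : (f s ^ 2)⁻¹ * deriv f s ≤ K := by
      rw [← div_eq_inv_mul, div_le_iff₀ hf2]
      exact hgrowth s hs
    linarith
  have hmono : MonotoneOn ψ (Ico a T) :=
    monotoneOn_of_deriv_nonneg (convex_Ico a T) hψcont hψdiff hψderiv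
  intro t ht
  have hft : 0 < f t := hpos t ht
  -- 1/f t ≤ 1/f s + K (s - t) for t ≤ s < T; and 1/f s can be made small
  have key : ∀ ε > 0, (f t)⁻¹ ≤ ε + K * (T - t) := by
    intro ε hε
    obtain ⟨s, hs, hNs⟩ := hub ε⁻¹ t ht.2
    have hsI : s ∈ Ico a T := ⟨ht.1.trans hs.1.le, hs.2⟩
    have hfs : 0 < f s := hpos s hsI
    have hm : (f t)⁻¹ + K * t ≤ (f s)⁻¹ + K * s := hmono ht hsI hs.1.le
    have hinv : (f s)⁻¹ ≤ ε := by
      rw [inv_le_comm₀ hfs hε]; exact hNs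
    have hKs : K * s ≤ K * T := mul_le_mul_of_nonneg_left hs.2.le hK
    have h3 : K * (T - t) = K * T - K * t := by ring
    linarith
  have hle : (f t)⁻¹ ≤ K * (T - t) := by
    apply le_of_forall_pos_lt_add
    intro ε hε
    have := key (ε / 2) (by positivity)
    linarith
  have h1 : (f t)⁻¹ * f t ≤ K * (T - t) * f t := mul_le_mul_of_nonneg_right hle hft.le
  rw [inv_mul_cancel₀ hft.ne'] at h1
  have h2 : K * (T - t) * f t = K * f t * (T - t) := by ring
  linarith

end Summit.NavierStokesRegularity.NavierStokesRegularity.Cruxes.LocallyDrivenIsTypeI.EvidenceC3
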